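import Summits.ValiantsHypothesis.ValiantsHypothesis.Theorems.KPlusLogSqLawTridiagonalRealStaticUnitSignAutomaton

/-!
# Route «KPlusLogSqLaw», crux `WeakLifting` (stmt-ValiantsHypothesis-19561) — REAL side of the tridiagonal sector:
# the WHOLE static definite tridiagonal sector (α register) — the pivot sign automaton as a ZERO-FREE ZONE LAW (all sizes, all coefficients)

HONEST FRAMING.  Helper theorems (`--supports stmt-ValiantsHypothesis-19561 --as helper`), seat val-sym-lift-p1 (g17), cell `pub-symmetroid`,
2026-08-28; lifts `…UnitSignAutomaton` (unit coefficients) to the general currency `StaticTridiagonalRealPotential.pathDet a d b f` of the α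
register: diagonal `a_t X^{d_t}` with `a_t > 0` (DEFINITE), links `b_t X^{f_t}` with `b_t ≠ 0`.  At a point `x > 0` write `α_k = a_k x^{d_k}`,
`β_k = b_k² x^{2f_k}`; the link `k` is RECESSIVE at `x` if `β_k < α_k α_{k+1}` (normalised link weight `b = β_k/(α_kα_{k+1}) < 1`) and DOMINANT if
`β_k > α_k α_{k+1}`.  The normalised pivots `π_{k+1} = D_{k+1}/(α_k D_k)` obey `π₁ = 1`, `π' = 1 − b/π` — the same recursion as in the unit slice,
so the SAME six-state automaton (`PState`, `step`, `runN`, `noZero` of `…UnitAutomatonDefs`) is sound here: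
* `step_sound_gen` — one edge with data `(α, α', β)`, `Q' = α'Q − βP`, in the abstract states `Realizes α 1 P Q` (the unit file's realisation
  predicate at exponent `1`, i.e. with the monomial `x^e` replaced by the positive real `α`);
* `runN_sound_gen`, **`pathDet_eval_ne_zero_of_automaton`** — ZERO-FREE ZONE LAW: if at `x > 0` no link is balanced (`β_k ≠ α_kα_{k+1}`) and the
  recessive/dominant word of the design AT `x` is accepted by the automaton (`noZero w n = true`, decidable for a concrete word), then
  `D_{n+1}(x) ≠ 0`.  Hence ALL positive determinant zeros of a static definite tridiagonal design lie at parameters whose local word is rejected;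
  the word is piecewise constant in `x` with breakpoints at the balance points `x_k = (a_k a_{k+1}/b_k²)^{1/L_k}` (`L_k = 2f_k − d_k − d_{k+1}`).
  Example consequence (`decide` on the word): wherever the links read «recessive, dominant, *, recessive, dominant, *, …» in vertex triples, the
  determinant does not vanish (the triple-block pattern), for every size and all coefficients.
Nothing here is an upper law for the register (α NO MOVER: the law locates zeros, it does not count them); nothing bears on `WeakLifting` /
`TropicalB` (stmt-19771) in their windows, Conjecture B, the Door-A registers, `MatrixDescartes` (stmt-18050) or VP ≠ VNP.
[this seat; folklore: LDLᵀ pivots of a Jacobi matrix]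
-/

-- `Summit.ValiantsHypothesis.ValiantsHypothesis.…` repeats a component by the D-0017 layout (single-conjunct summit); the name is mandated.
set_option linter.dupNamespace false
set_option autoImplicit false

namespace Summit.ValiantsHypothesis.ValiantsHypothesis.Theorems.KPlusLogSqLaw
namespace StaticTridiagonalRealUnit

open Polynomial Finset
open Summit.ValiantsHypothesis.ValiantsHypothesis.Theorems.KPlusLogSqLaw.StaticTridiagonalRealPotential
  (pathDet pathDet_zero pathDet_one pathDet_add_two)
open PState

/-! ### One edge with general positive data -/

/-- **one edge is sound (general coefficients)**: from a pair realising a state with pivot scale `α > 0`, the new pair `(Q, α'Q − βP)`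
(`α', β > 0`) realises a successor state of `step rec`, where `rec` means `β < αα'` and `¬rec` means `αα' < β`. [this file] -/
theorem step_sound_gen {α α' β P Q σ : ℝ} (hα : 0 < α) (hα' : 0 < α') (hβ : 0 < β) (hσ : σ = 1 ∨ σ = -1) {s : PState} (rec : Bool)
    (hreal : Realizes α 1 P Q s σ) (hb : if rec then β < α * α' else α * α' < β) :
    ∃ p ∈ step rec s, Realizes α' 1 Q (α' * Q - β * P) p.1 (flipIf p.2 σ) := by
  have key : σ * (α' * Q - β * P) = α' * (σ * Q) - β * (σ * P) := by ring
  cases s with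
  | E =>
    obtain ⟨hP, hQ⟩ := hreal
    rw [pow_one] at hQ
    have hQ' : σ * (α' * Q - β * P) = (σ * P) * (α * α' - β) := by rw [key, hQ]; ring
    cases rec with
    | true =>
      simp only [ite_true] at hb
      refine ⟨(A, false), by simp [step], ?_⟩
      simp only [Realizes, flipIf, pow_one]
      refine ⟨by rw [hQ']; nlinarith, ?_⟩
      rw [key]; nlinarith [mul_pos hβ hP]
    | false =>
      simp only [Bool.false_eq_true, ↓reduceIte] at hb
      refine ⟨(N, true), by simp [step], ?_⟩
      simp only [Realizes, flipIf, neg_mul]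
      refine ⟨by rw [hQ']; nlinarith, by rw [hQ]; nlinarith [mul_pos hα hP]⟩
  | N =>
    obtain ⟨hQ, hP⟩ := hreal
    refine ⟨(J, false), by simp [step], ?_⟩
    simp only [Realizes, flipIf, pow_one]
    refine ⟨hQ, ?_⟩
    rw [key]; nlinarith [mul_pos hβ (neg_pos.2 hP)]
  | A =>
    obtain ⟨hQ, hQP⟩ := hreal
    rw [pow_one] at hQP
    have hP : 0 < σ * P := by nlinarith
    have hlt : σ * (α' * Q - β * P) < α' * (σ * Q) := by rw [key]; nlinarith [mul_pos hβ hP]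
    cases rec with
    | true =>
      rcases lt_trichotomy (σ * (α' * Q - β * P)) 0 with h | h | h
      · refine ⟨(N, true), by simp [step], ?_⟩
        simp only [Realizes, flipIf, neg_mul]
        exact ⟨by linarith, by linarith⟩
      · refine ⟨(Z, false), by simp [step], ?_⟩
        simp only [Realizes, flipIf]
        refine ⟨?_, hQ⟩
        rcases hσ with h1 | h1 <;> simp [h1] at h ⊢ <;> linarith
      · refine ⟨(A, false), by simp [step], ?_⟩
        simp only [Realizes, flipIf, pow_one]
        exact ⟨h, hlt⟩
    | false =>
      simp only [Bool.false_eq_true, ↓reduceIte] at hb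
      refine ⟨(N, true), by simp [step], ?_⟩
      simp only [Realizes, flipIf, neg_mul]
      have : α' * (σ * Q) < α' * (α * (σ * P)) := mul_lt_mul_of_pos_left hQP hα'
      refine ⟨?_, by linarith⟩
      rw [key]; nlinarith [mul_pos hα hP]
  | J =>
    obtain ⟨hP, hPQ⟩ := hreal
    rw [pow_one] at hPQ
    have hQ : 0 < σ * Q := by nlinarith [mul_pos hα hP]
    have hlt : σ * (α' * Q - β * P) < α' * (σ * Q) := by rw [key]; nlinarith [mul_pos hβ hP]
    cases rec with
    | true =>
      simp only [ite_true] at hb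
      refine ⟨(A, false), by simp [step], ?_⟩
      simp only [Realizes, flipIf, pow_one]
      refine ⟨?_, hlt⟩
      have : α' * (α * (σ * P)) < α' * (σ * Q) := mul_lt_mul_of_pos_left hPQ hα'
      rw [key]; nlinarith [mul_pos hα hP]
    | false =>
      rcases lt_trichotomy (σ * (α' * Q - β * P)) 0 with h | h | h
      · refine ⟨(N, true), by simp [step], ?_⟩
        simp only [Realizes, flipIf, neg_mul]
        exact ⟨by linarith, by linarith⟩
      · refine ⟨(Z, false), by simp [step], ?_⟩
        simp only [Realizes, flipIf]
        refine ⟨?_, hQ⟩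
        rcases hσ with h1 | h1 <;> simp [h1] at h ⊢ <;> linarith
      · refine ⟨(A, false), by simp [step], ?_⟩
        simp only [Realizes, flipIf, pow_one]
        exact ⟨h, hlt⟩
  | Z =>
    obtain ⟨hQ0, hP⟩ := hreal
    refine ⟨(P0, true), by simp [step], ?_⟩
    simp only [Realizes, flipIf, neg_mul]
    refine ⟨hQ0, ?_⟩
    rw [key, hQ0, mul_zero, mul_zero, zero_sub]; nlinarith [mul_pos hβ hP]
  | P0 =>
    obtain ⟨hP0, hQ⟩ := hreal
    refine ⟨(E, false), by simp [step], ?_⟩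
    simp only [Realizes, flipIf, pow_one]
    refine ⟨hQ, ?_⟩
    rw [key, hP0, mul_zero, mul_zero, sub_zero]

/-! ### The run along a static definite tridiagonal design -/

variable (a : ℕ → ℝ) (d : ℕ → ℕ) (b : ℕ → ℝ) (f : ℕ → ℕ)

/-- evaluation form of the general recurrence: `D_{n+2}(x) = (a_{n+1} x^{d_{n+1}})·D_{n+1}(x) − (b_n² x^{2f_n})·D_n(x)`. [folklore] -/
theorem eval_pathDet_add_two (x : ℝ) (n : ℕ) :
    (pathDet a d b f (n + 2)).eval x =
      (a (n + 1) * x ^ d (n + 1)) * (pathDet a d b f (n + 1)).eval x - (b n ^ 2 * x ^ (2 * f n)) * (pathDet a d b f n).eval x := by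
  rw [pathDet_add_two]
  simp only [eval_sub, eval_mul, eval_pow, eval_C, eval_X]
  ring

/-- **the run is sound (general coefficients)**: if `w` marks exactly the recessive links at `x` (and no link is balanced), the pair
`(D_n, D_{n+1})(x)` realises some branch of `runN w n`, with pivot scale `a_n x^{d_n}`. [this file] -/
theorem runN_sound_gen (ha : ∀ k, 0 < a k) {x : ℝ} (hx : 0 < x) (w : ℕ → Bool) (n : ℕ)
    (hw : ∀ k, k < n → if w k then b k ^ 2 * x ^ (2 * f k) < (a k * x ^ d k) * (a (k + 1) * x ^ d (k + 1))
      else (a k * x ^ d k) * (a (k + 1) * x ^ d (k + 1)) < b k ^ 2 * x ^ (2 * f k))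
    (hb : ∀ k, k < n → b k ≠ 0) :
    ∃ p ∈ runN w n, Realizes (a n * x ^ d n) 1 ((pathDet a d b f n).eval x) ((pathDet a d b f (n + 1)).eval x) p.1 (sgn p.2) := by
  induction n with
  | zero =>
    refine ⟨(E, false), by simp [runN], ?_⟩
    rw [pathDet_zero, pathDet_one]
    have hs : sgn false = 1 := by simp [sgn]
    rw [hs]
    simp only [Realizes, eval_one, eval_mul, eval_C, eval_pow, eval_X, pow_one, one_mul]
    exact ⟨one_pos, (mul_one _).symm⟩
  | succ n ih =>
    obtain ⟨p, hp, hreal⟩ := ih (fun k hk => hw k (Nat.lt_succ_of_lt hk)) (fun k hk => hb k (Nat.lt_succ_of_lt hk))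
    have hσ : sgn p.2 = 1 ∨ sgn p.2 = -1 := by cases p.2 <;> simp [sgn]
    have hα : 0 < a n * x ^ d n := mul_pos (ha n) (pow_pos hx _)
    have hα' : 0 < a (n + 1) * x ^ d (n + 1) := mul_pos (ha (n + 1)) (pow_pos hx _)
    have hβ : 0 < b n ^ 2 * x ^ (2 * f n) := mul_pos (sq_pos_iff.2 (hb n (Nat.lt_succ_self n))) (pow_pos hx _)
    obtain ⟨q, hq, hq'⟩ := step_sound_gen hα hα' hβ hσ (w n) hreal (hw n (Nat.lt_succ_self n))
    refine ⟨(q.1, xor p.2 q.2), ?_, ?_⟩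
    · simp only [runN, List.mem_flatMap, List.mem_map]
      exact ⟨p, hp, q, hq, rfl⟩
    · rw [show n + 1 + 1 = n + 2 from rfl, eval_pathDet_add_two]
      have hs : sgn (xor p.2 q.2) = flipIf q.2 (sgn p.2) := by
        rw [sgn_xor]; cases q.2 <;> simp [sgn, flipIf]
      rw [hs]
      exact hq'

/-- **ZERO-FREE ZONE LAW (whole static definite tridiagonal sector, all sizes).**  Let `a_k > 0` and `b_k ≠ 0` (`k < n`).  At a point `x > 0`
let `w k` record the recessive links (`b_k² x^{2f_k} < a_k a_{k+1} x^{d_k+d_{k+1}}`), the other links being strictly dominant.  If the automaton run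
of `w` avoids the zero state (`noZero w n = true`), then `D_{n+1}(x) ≠ 0`. [this file] -/
theorem pathDet_eval_ne_zero_of_automaton (ha : ∀ k, 0 < a k) {x : ℝ} (hx : 0 < x) (w : ℕ → Bool) (n : ℕ)
    (hw : ∀ k, k < n → if w k then b k ^ 2 * x ^ (2 * f k) < (a k * x ^ d k) * (a (k + 1) * x ^ d (k + 1))
      else (a k * x ^ d k) * (a (k + 1) * x ^ d (k + 1)) < b k ^ 2 * x ^ (2 * f k))
    (hb : ∀ k, k < n → b k ≠ 0) (hz : noZero w n = true) :
    (pathDet a d b f (n + 1)).eval x ≠ 0 := by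
  obtain ⟨p, hp, hreal⟩ := runN_sound_gen a d b f ha hx w n hw hb
  have hpZ : p.1 ≠ Z := by
    have := List.all_eq_true.1 hz p hp
    simpa using this
  exact ne_zero_of_realizes hreal hpZ (mul_pos (ha n) (pow_pos hx _))

/-- **unit-ratio coefficients behave like the unit slice**: if `a_k a_{k+1} = b_k²` then on `(0,1)` the link `k` is recessive exactly when its
slope is ascending (`d_k + d_{k+1} < 2f_k`). [this file] -/
theorem recessive_of_unitRatio_lt_one {x : ℝ} (hx : 0 < x) (hx1 : x < 1) (k : ℕ) (hcoef : a k * a (k + 1) = b k ^ 2) (hbk : b k ≠ 0)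
    (hL : d k + d (k + 1) < 2 * f k) :
    b k ^ 2 * x ^ (2 * f k) < (a k * x ^ d k) * (a (k + 1) * x ^ d (k + 1)) := by
  have hb2 : 0 < b k ^ 2 := sq_pos_iff.2 hbk
  have e : (a k * x ^ d k) * (a (k + 1) * x ^ d (k + 1)) = b k ^ 2 * x ^ (d k + d (k + 1)) := by rw [← hcoef, pow_add]; ring
  rw [e]
  exact mul_lt_mul_of_pos_left (pow_lt_pow_right_of_lt_one₀ hx hx1 hL) hb2

/-- companion: a descending slope (`2f_k < d_k + d_{k+1}`) with unit coefficient ratio is dominant on `(0,1)`. [this file] -/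
theorem dominant_of_unitRatio_lt_one {x : ℝ} (hx : 0 < x) (hx1 : x < 1) (k : ℕ) (hcoef : a k * a (k + 1) = b k ^ 2) (hbk : b k ≠ 0)
    (hL : 2 * f k < d k + d (k + 1)) :
    (a k * x ^ d k) * (a (k + 1) * x ^ d (k + 1)) < b k ^ 2 * x ^ (2 * f k) := by
  have hb2 : 0 < b k ^ 2 := sq_pos_iff.2 hbk
  have e : (a k * x ^ d k) * (a (k + 1) * x ^ d (k + 1)) = b k ^ 2 * x ^ (d k + d (k + 1)) := by rw [← hcoef, pow_add]; ring
  rw [e]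
  exact mul_lt_mul_of_pos_left (pow_lt_pow_right_of_lt_one₀ hx hx1 hL) hb2

end StaticTridiagonalRealUnit
end Summit.ValiantsHypothesis.ValiantsHypothesis.Theorems.KPlusLogSqLaw
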